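import Summits.Ventures.PercRepro.RankLevelSetLevelSixT18Cell7
import Summits.Ventures.PercRepro.RankLevelSetLevelSixT18Cell8
import Summits.Ventures.PercRepro.RankLevelSetLevelSixT18Cell9
import Summits.Ventures.PercRepro.RankLevelSetLevelSixT18Cell10
import Summits.Ventures.PercRepro.RankLevelSetLevelSixT18Cell11
import Summits.Ventures.PercRepro.RankLevelSetLevelSixT18Cell12
import Summits.Ventures.PercRepro.RankLevelSetLevelSixT18Cell13
import Summits.Ventures.PercRepro.RankLevelSetLevelSixT18Cell14
import Summits.Ventures.PercRepro.RankLevelSetLevelSixT18Cell15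
import Summits.Ventures.PercRepro.RankLevelSetLevelSixT18Cell16
import Summits.Ventures.PercRepro.RankLevelSetLevelSixT18Cell17
import Summits.Ventures.PercRepro.RankLevelSetLevelSixT18Cell18
import Summits.Ventures.PercRepro.RankLevelSetLevelSixT18Cell19
import Summits.Ventures.PercRepro.RankLevelSetLevelSixT18Cell20
import Summits.Ventures.PercRepro.RankLevelSetLevelSixT18Cell21
import Summits.Ventures.PercRepro.RankLevelSetLevelSixT18Cell22
import Summits.Ventures.PercRepro.RankLevelSetLevelSixT18Cell23
import Summits.Ventures.PercRepro.RankLevelSetLevelSixT18Cell24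
import Summits.Ventures.PercRepro.RankLevelSetLevelSixT18Cell25
import Summits.Ventures.PercRepro.RankLevelSetLevelSixT18Cell26
import Summits.Ventures.PercRepro.RankLevelSetLevelSixT18Cell27
import Summits.Ventures.PercRepro.RankLevelSetLevelSixT18Cell28
import Summits.Ventures.PercRepro.RankLevelSetLevelSixT18Cell29
import Summits.Ventures.PercRepro.RankLevelSetLevelSixT18Cell30
import Summits.Ventures.PercRepro.RankLevelSetLevelSixT18Cell31
import Summits.Ventures.PercRepro.RankLevelSetLevelSixT18Cell32
import Summits.Ventures.PercRepro.RankLevelSetLevelSixT18Cell33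
import Summits.Ventures.PercRepro.RankLevelSetLevelSixT18Cell34
import Summits.Ventures.PercRepro.RankLevelSetLevelSixT18Cell35
import Summits.Ventures.PercRepro.RankLevelSetLevelSixT18Cell36
import Summits.Ventures.PercRepro.RankLevelSetLevelSixT18BasisMid1
import Summits.Ventures.PercRepro.RankLevelSetLevelSixT18BasisMid2
import Summits.Ventures.PercRepro.RankLevelSetLevelSixT18RegII
import Summits.Ventures.PercRepro.RankLevelSetLevelSixT19Assembly
import Summits.Ventures.PercRepro.RankLevelSetLevelFiveCqFifteen

/-!
# PercRepro — THE 18 ROW: `c025_six_large_eighteen (18 ≤ p) : RLS M p 6` — C-025 AT LEVEL `6` FOR EVERY `p ≥ 18`, EVERY FINITE MATROID (p8 g15, S3)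

The core cells `(18, d)`: `d ∈ [7, 8, 9, 10, 11, 12, 13, 14, 15, 16, 17, 18, 19, 20, 21, 22, 23, 24, 25, 26, 27, 28, 29, 30, 31, 32, 33, 34, 35, 36]` by THE COLOOP DEVICE WITH THE LP CHAIN (`c025_core_six_eighteen_d`: `k = 0` and the chain
steps the coloop-free cells of p2's nullity-split coloop/closure LP run at level `6` (`S3LP.s6lp_*`, natural or scaled), then the
exported-count rows and the trivial rows), `37 … 45, 46 … 50` by the basis cells
(`c025_core_six_t18_basis_mid1, c025_core_six_t18_basis_mid2`), `d ≥ 51` by regime II (`c025_core_six_regII_basis_18`). Then the level-5 glue: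
`rls_six_at_of_core 18` on p7's `c025_five_large_sharp15` (level `5` at `p = 17`) and the 19 row (`c025_six_large_nineteen`) for `p ≥ 19`.
Axioms: standard.
-/

open scoped Matroid

namespace PercRepro

namespace ThmN

variable {α : Type}

/-- **The core cell `(18, d)` at every corank `d ≥ 37`, every `e`-free core** (the basis cells and regime II). -/
theorem c025_core_six_eighteen_large (M : Matroid α) [M.Finite] (d : ℕ) (hd : 37 ≤ d)
    (hR : M.eRank = (18 : ℕ∞)) (hn : M.E.ncard = 18 + d)
    (hfree : ∀ e ∈ M.E, ∃ A ⊆ M.E \ {e}, e ∉ M.closure A ∧ e ∉ M.closure ((M.E \ {e}) \ A)) :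
    RLS M 18 6 := by
  rcases Nat.lt_or_ge d 46 with h45 | h45'
  · exact c025_core_six_t18_basis_mid1 M d (by omega) (by omega) hR hn hfree
  rcases Nat.lt_or_ge d 51 with h50 | h50'
  · exact c025_core_six_t18_basis_mid2 M d (by omega) (by omega) hR hn hfree
  exact c025_core_six_regII_basis_18 M d (by omega) hR hn hfree

/-- **The core cell `(18, d)` at every corank `d ≥ 7`, every `e`-free core.** -/
theorem c025_core_six_eighteen (M : Matroid α) [M.Finite] (d : ℕ) (hd7 : 7 ≤ d)
    (hR : M.eRank = (18 : ℕ∞)) (hn : M.E.ncard = 18 + d)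
    (hfree : ∀ e ∈ M.E, ∃ A ⊆ M.E \ {e}, e ∉ M.closure A ∧ e ∉ M.closure ((M.E \ {e}) \ A)) :
    RLS M 18 6 := by
  rcases Nat.lt_or_ge d 37 with hlt | hge
  · interval_cases d
    · exact c025_core_six_eighteen_7 M hR hn hfree
    · exact c025_core_six_eighteen_8 M hR hn hfree
    · exact c025_core_six_eighteen_9 M hR hn hfree
    · exact c025_core_six_eighteen_10 M hR hn hfree
    · exact c025_core_six_eighteen_11 M hR hn hfree
    · exact c025_core_six_eighteen_12 M hR hn hfree
    · exact c025_core_six_eighteen_13 M hR hn hfree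
    · exact c025_core_six_eighteen_14 M hR hn hfree
    · exact c025_core_six_eighteen_15 M hR hn hfree
    · exact c025_core_six_eighteen_16 M hR hn hfree
    · exact c025_core_six_eighteen_17 M hR hn hfree
    · exact c025_core_six_eighteen_18 M hR hn hfree
    · exact c025_core_six_eighteen_19 M hR hn hfree
    · exact c025_core_six_eighteen_20 M hR hn hfree
    · exact c025_core_six_eighteen_21 M hR hn hfree
    · exact c025_core_six_eighteen_22 M hR hn hfree
    · exact c025_core_six_eighteen_23 M hR hn hfree
    · exact c025_core_six_eighteen_24 M hR hn hfree
    · exact c025_core_six_eighteen_25 M hR hn hfree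
    · exact c025_core_six_eighteen_26 M hR hn hfree
    · exact c025_core_six_eighteen_27 M hR hn hfree
    · exact c025_core_six_eighteen_28 M hR hn hfree
    · exact c025_core_six_eighteen_29 M hR hn hfree
    · exact c025_core_six_eighteen_30 M hR hn hfree
    · exact c025_core_six_eighteen_31 M hR hn hfree
    · exact c025_core_six_eighteen_32 M hR hn hfree
    · exact c025_core_six_eighteen_33 M hR hn hfree
    · exact c025_core_six_eighteen_34 M hR hn hfree
    · exact c025_core_six_eighteen_35 M hR hn hfree
    · exact c025_core_six_eighteen_36 M hR hn hfree
  · exact c025_core_six_eighteen_large M d hge hR hn hfree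

/-- **THEOREM C₆ AT RANK `18`, GIVEN LEVEL `5`**: level `5` for all `p ≥ 17` implies level `6` for all `p ≥ 18`
(`p = 18` by the cells and `rls_six_at_of_core`; `p ≥ 19` by the 19 row). -/
theorem c025_six_of_five_t18
    (h5 : ∀ (M : Matroid α) [M.Finite] (p : ℕ), 17 ≤ p → RLS M p 5) :
    ∀ (M : Matroid α) [M.Finite] (p : ℕ), 18 ≤ p → RLS M p 6 := by
  intro M _ p hp
  rcases Nat.lt_or_ge p 19 with hlt | hge
  · have hP : p = 18 := by omega
    subst hP
    refine rls_six_at_of_core 18 (by norm_num) (fun M _ => h5 M 17 (by norm_num)) ?_ M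
    intro M _ d hd hR hn hfree
    exact c025_core_six_eighteen M d hd hR hn hfree
  · exact c025_six_large_nineteen M p hge

/-- **C-025 AT LEVEL `6` FOR EVERY `p ≥ 18`, EVERY FINITE MATROID** — on p7's `c025_five_large_sharp15 (15 ≤ p)`. -/
theorem c025_six_large_eighteen (M : Matroid α) [M.Finite] (p : ℕ) (hp : 18 ≤ p) : RLS M p 6 :=
  c025_six_of_five_t18 (fun M _ p hp => c025_five_large_sharp15 M p (by omega)) M p hp

end ThmN

end PercRepro
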